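import Summits.ResolutionOfSingularities.ResolutionOfSingularities.Theorems.PurelyInseparableDim4SpineCertCycles
import Summits.ResolutionOfSingularities.ResolutionOfSingularities.Theorems.PurelyInseparableDim4SpineCF
import HarnessLib
import HarnessLib.Audit.Tags

/-!
# Purely inseparable fourfolds — N-CF∀: a TIE-FREE cardinality-first 3-cycle; NO cardinality-first tie-breaking wins Hironaka's game (n = 4, q = 2)

Census cell «res-dim4-pi» (D-0157 DOOR 2), seat res-dim4-p-8 (desk WORD #36 (a): «p-8 files `…SpineCertCF3.lean`»;
specimen = eng-w5 RUN 6 / EN-11-EXT j313414 trap d08a30912151a2cd, K ✓ EXACT res-dim4-p-7 18:11:31Z).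
[OURS · counted 0 · AI kernel work, weaker than expert review.]  A LOCATED NEGATIVE about OUR cardinality-first
rule (the support shadow of MODE 1h) — NOT about Spivakovsky's theorem (`purePositionalWin4_iff_pos`, p651534:
SOME permissible rule wins from every position) and NOT about resolution of singularities, which is NOT proved in
dimension ≥ 4 / characteristic `p` anywhere in this programme.

THE SPECIMEN (reached from the clean root `x₂x₃x₄⁵ + x₁x₂x₃⁶ + x₁⁵x₂²x₄`, degree 8 — outside the `D ≤ 6` census,
where cardinality-first with free ties wins from every root, EN-11):
`P₀ = {(1,0,5,0),(1,2,0,5),(5,3,0,1)} —({x₂,x₃}, x₂)→ P₁ = {(1,3,5,0),(1,0,0,5),(5,1,0,1)} —({x₂,x₄}, x₂)→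
 P₂ = {(1,1,5,0),(1,3,0,5),(5,0,0,1)} —({x₁,x₂}, x₂)→ P₀`,
and at EACH `Pᵢ` the permissible centre of least cardinality is UNIQUE (no permissible divisor, exactly one
permissible plane).  Hence every cardinality-first positional strategy, WHATEVER ITS TIE-BREAKING, plays these three
centres there, and player B's constant answer «chart x₂» is an infinite play:

* §1 `cycleCert_cf3` (the literal 3-cycle, `decide`), `cardFirstB_cf3_unique` (uniqueness of the cardinality-first
  centre at the three positions, `decide`), `cf3_noDeletion`;
* §2 generic: `CycleCert.isPurePlay_of_forced` / `isSpinePlay_of_forced` (a certified cycle whose centres a strategy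
  is FORCED to play is an infinite play of that strategy) and `CycleCert.forced_of_unique` (uniqueness of the
  cardinality-first centre forces every cardinality-first strategy);
* §3 **`not_isPurePositionalWin_of_cardFirst_two`**: NO positional strategy of Hironaka's pure game (`q = 2`, four
  variables) that picks a permissible centre of least cardinality at every not-yet-won position is a positional win;
  the same for the game with deletions (`not_isSpinePositionalWin_of_cardFirst_two`); hence
  **`not_exists_cardFirst_purePositionalWin_two`** — the ∀-tie-break strengthening (N-CF∀) of
  `SpineCertCycles.exists_cardFirst_strategy_not_purePositionalWin_two` — and, read through `res-dim4-p-10`'s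
  reduction `SpineCF.exists_cardFirst_purePositionalWin_of_weakWinCF_three_four`, **`not_forall_weakWinCF_three_four`**:
  cardinality-first does NOT force Spivakovsky's weak win in every set of ≥ 3 active coordinates of `Fin 4`
  (the consortium's hypothesis-shape `PolyhedraGame.WeakWinCF` fails somewhere in dimension 3 or 4).

[cite: Spivakovsky1983, §1 (Hironaka's polyhedra game)]; specimen OURS (eng-w5 RUN 6; K res-dim4-p-7).
bears_on: LADDER-RESOLUTION:D157-DOOR2 (res-dim4-pi · N-CF∀ · Q-CF∀ retired). Supports stmt-ResolutionOfSingularities-16155 (helper).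
-/

-- cell convention (DR-157-C): the summit's doubled path segment is intended, as in the landed Target file
set_option linter.dupNamespace false

namespace Summit.ResolutionOfSingularities.ResolutionOfSingularities.Theorems.PIDim4.SpineCert

open Finset
open Literature.AlgebraicGeometry.Resolution

/-! ## 1. The tie-free 3-cycle (eng-w5 RUN 6, trap d08a30912151a2cd) -/

/-- `P₀ = supp(x₁x₃⁵ + x₁x₂²x₄⁵ + x₁⁵x₂³x₄)`. [folklore] -/
def cf3P₀ : Finset (Fin 4 → ℕ) := {![1, 0, 5, 0], ![1, 2, 0, 5], ![5, 3, 0, 1]}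

/-- `P₁ = supp(x₁x₂³x₃⁵ + x₁x₄⁵ + x₁⁵x₂x₄)`. [folklore] -/
def cf3P₁ : Finset (Fin 4 → ℕ) := {![1, 3, 5, 0], ![1, 0, 0, 5], ![5, 1, 0, 1]}

/-- `P₂ = supp(x₁x₂x₃⁵ + x₁x₂³x₄⁵ + x₁⁵x₄)`. [folklore] -/
def cf3P₂ : Finset (Fin 4 → ℕ) := {![1, 1, 5, 0], ![1, 3, 0, 5], ![5, 0, 0, 1]}

/-- The certificate `P₀ —({x₂,x₃}, x₂)→ P₁ —({x₂,x₄}, x₂)→ P₂ —({x₁,x₂}, x₂)→ P₀`. [folklore] -/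
def cf3 : List (Finset (Fin 4 → ℕ) × Finset (Fin 4) × Fin 4) :=
  [(cf3P₀, {1, 2}, 1), (cf3P₁, {1, 3}, 1), (cf3P₂, {0, 1}, 1)]

/-- **The 3-cycle is a literal cardinality-first cycle of the pure game at `q = 2`** (kernel check). [OURS · ‖ K] [folklore] -/
theorem cycleCert_cf3 : CycleCert 2 cf3 := by
  unfold CycleCert cf3 cf3P₀ cf3P₁ cf3P₂
  decide

/-- **TIE-FREENESS**: at each of the three positions the cardinality-first centre is UNIQUE — the only
permissible centre of least cardinality is the one the cycle uses (kernel check over all 16 subsets). [OURS · ‖ K] [folklore] -/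
theorem cardFirstB_cf3_unique :
    ∀ k : Fin cf3.length, ∀ J : Finset (Fin 4), cardFirstB 2 J (cf3.get k).1 = true → J = (cf3.get k).2.1 := by
  unfold cf3 cf3P₀ cf3P₁ cf3P₂
  decide

/-- No cleaning deletion occurs on the three edges (the cycle is also one of the game WITH deletions). [OURS · ‖ K] [folklore] -/
theorem cf3_noDeletion : ∀ k : Fin cf3.length,
    spineMoveC 2 (cf3.get k).2.1 (cf3.get k).2.2 (cf3.get k).1 =
      pureMoveC 2 (cf3.get k).2.1 (cf3.get k).2.2 (cf3.get k).1 := by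
  unfold cf3 cf3P₀ cf3P₁ cf3P₂
  decide

/-! ## 2. Forced strategies follow a certified cycle -/

namespace CycleCert

variable {q : ℕ} {L : List (Finset (Fin 4 → ℕ) × Finset (Fin 4) × Fin 4)}

/-- If a strategy plays the certified centre at every position of the certificate, the periodic play follows
it: an infinite PURE play of that strategy. [folklore] -/
theorem isPurePlay_of_forced (h : CycleCert q L) (σ : SpineStrategy)
    (hforced : ∀ k : Fin L.length, σ (ofC (L.get k).1) = (L.get k).2.1) :
    IsPurePlay q σ fun n => ofC (h.play n) := by
  intro n
  have hσ : σ (ofC (h.play n)) = h.centre n := hforced (h.idx n)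
  refine ⟨?_, h.chart n, ?_, ?_⟩
  · rw [spineWon_ofC_iff, h.not_won n]
    exact Bool.false_ne_true
  · rw [hσ]
    exact h.chart_mem n
  · show ofC (h.play (n + 1)) = pureMove q (σ (ofC (h.play n))) (h.chart n) (ofC (h.play n))
    rw [hσ, pureMove_ofC, h.play_succ n]

/-- The same for the game with deletions, when none occurs on the certified edges. [folklore] -/
theorem isSpinePlay_of_forced (h : CycleCert q L) (σ : SpineStrategy)
    (hforced : ∀ k : Fin L.length, σ (ofC (L.get k).1) = (L.get k).2.1)
    (hdel : ∀ k : Fin L.length,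
      spineMoveC q (L.get k).2.1 (L.get k).2.2 (L.get k).1 = pureMoveC q (L.get k).2.1 (L.get k).2.2 (L.get k).1) :
    IsSpinePlay q σ fun n => ofC (h.play n) := by
  intro n
  have hσ : σ (ofC (h.play n)) = h.centre n := hforced (h.idx n)
  refine ⟨?_, h.chart n, ?_, ?_⟩
  · rw [spineWon_ofC_iff, h.not_won n]
    exact Bool.false_ne_true
  · rw [hσ]
    exact h.chart_mem n
  · show ofC (h.play (n + 1)) = spineMove q (σ (ofC (h.play n))) (h.chart n) (ofC (h.play n))
    rw [hσ, spineMove_ofC, h.play_succ n]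
    exact congrArg ofC (hdel (h.idx n)).symm

/-- **Uniqueness forces.**  If at every position of the certificate the certified centre is the ONLY
cardinality-first permissible centre, then every strategy that is permissible and of least cardinality at
not-yet-won positions plays the certified centres there. [folklore] -/
theorem forced_of_unique (h : CycleCert q L)
    (huniq : ∀ k : Fin L.length, ∀ J : Finset (Fin 4), cardFirstB q J (L.get k).1 = true → J = (L.get k).2.1)
    (σ : SpineStrategy)
    (hperm : ∀ A : SpinePos, ¬ SpineWon q A → SpinePermissible q (σ A) A)
    (hmin : ∀ A : SpinePos, ¬ SpineWon q A → ∀ J' : Finset (Fin 4), SpinePermissible q J' A → (σ A).card ≤ J'.card) :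
    ∀ k : Fin L.length, σ (ofC (L.get k).1) = (L.get k).2.1 := by
  intro k
  -- the position is not won (it is an entry of the certificate)
  have hstep := (stepB_eq_true_iff _ _ _ _ _).mp (h.2.2 k)
  have hnotwon : ¬ SpineWon q (ofC (L.get k).1) := by
    rw [spineWon_ofC_iff, hstep.1]
    exact Bool.false_ne_true
  refine huniq k _ ((cardFirstB_eq_true_iff _ _ _).mpr ⟨?_, fun J' hJ' => ?_⟩)
  · exact (spinePermissible_ofC_iff q _ _).mp (hperm _ hnotwon)
  · exact hmin _ hnotwon J' ((spinePermissible_ofC_iff q J' _).mpr hJ')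

end CycleCert

/-! ## 3. N-CF∀ at (n, q) = (4, 2) -/

/-- **No cardinality-first positional strategy wins Hironaka's pure game in four variables at `q = 2`**:
every strategy that is permissible and of least cardinality at every not-yet-won position (whatever its
tie-breaking, whatever else it reads) admits the infinite play `P₀ → P₁ → P₂ → P₀ → …` (player B answering
chart `x₂`), hence is not a positional win. [OURS · ‖ K] [folklore] -/
theorem not_isPurePositionalWin_of_cardFirst_two (σ : SpineStrategy)
    (hmin : ∀ A : SpinePos, ¬ SpineWon 2 A →
      ∀ J' : Finset (Fin 4), SpinePermissible 2 J' A → (σ A).card ≤ J'.card) :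
    ¬ IsPurePositionalWin 2 σ := by
  intro hwin
  have hforced := cycleCert_cf3.forced_of_unique cardFirstB_cf3_unique σ hwin.1 hmin
  exact hwin.2 ⟨_, cycleCert_cf3.isPurePlay_of_forced σ hforced⟩

/-- The same for the spine game WITH the cleaning deletions (`PositionalWin4`'s game): no cardinality-first
positional strategy is a positional win. [OURS · ‖ K] [folklore] -/
theorem not_isSpinePositionalWin_of_cardFirst_two (σ : SpineStrategy)
    (hmin : ∀ A : SpinePos, ¬ SpineWon 2 A →
      ∀ J' : Finset (Fin 4), SpinePermissible 2 J' A → (σ A).card ≤ J'.card) :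
    ¬ IsSpinePositionalWin 2 σ := by
  intro hwin
  have hforced := cycleCert_cf3.forced_of_unique cardFirstB_cf3_unique σ hwin.1 hmin
  exact hwin.2 ⟨_, cycleCert_cf3.isSpinePlay_of_forced σ hforced cf3_noDeletion⟩

/-- **N-CF∀ (the located negative of WORD #36 (a)).**  There is NO positional strategy of Hironaka's pure polyhedra
game in four variables at `q = 2` that is cardinality-first (least cardinality among the permissible centres at
every not-yet-won position) and wins from every position — in the exact shape of the conclusion of
`SpineCF.exists_cardFirst_purePositionalWin_of_weakWinCF`. [OURS · ‖ K] [folklore] -/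
theorem not_exists_cardFirst_purePositionalWin_two :
    ¬ ∃ σ : SpineStrategy, IsPurePositionalWin 2 σ ∧
      ∀ A : SpinePos, ¬ SpineWon 2 A →
        ∀ J' : Finset (Fin 4), SpinePermissible 2 J' A → (σ A).card ≤ J'.card :=
  fun ⟨σ, hwin, hmin⟩ => not_isPurePositionalWin_of_cardFirst_two σ hmin hwin

/-- **Consequence for the consortium's reduction** (`res-dim4-p-10`, PR-9d): the hypothesis-shape
`PolyhedraGame.WeakWinCF` — «cardinality-first forces Spivakovsky's weak win» — FAILS for some set of at least
three active coordinates of `Fin 4` (it holds for ≤ 2 by `PolyhedraCFTwo`). [OURS · ‖ K] [folklore] -/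
theorem not_forall_weakWinCF_three_four :
    ¬ ∀ I : Finset (Fin 4), 3 ≤ I.card → PolyhedraGame.WeakWinCF (Fin 4) I :=
  fun h => not_exists_cardFirst_purePositionalWin_two
    (SpineCF.exists_cardFirst_purePositionalWin_of_weakWinCF_three_four h (by norm_num))

end Summit.ResolutionOfSingularities.ResolutionOfSingularities.Theorems.PIDim4.SpineCert
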